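import Summits.CriticalPhenomena.CardyFormulaZ2.Theorems.CardyIKTransportIKLinearTransportWallDominationDefs

/-!
# `CardyIKTransport.IKLinearTransport` (stmt-CriticalPhenomena-5076, line `pinned-diagram-exchange`, lead c8 wave 1) —
# WALL DOMINATION: the registered sub-goal `stub_lastColMonoGen` (pointwise last-column monotonicity for
# wall-monotone events)

Support file (`--supports stmt-CriticalPhenomena-5076`), sorry-free.

`stub_lastColMonoGen : H1Gen → LinkConstGen → LastColMonoGen` is the sister line's `lastColLinkMono_of`
(`…TransportLinkDefs.lean`) with the ARCS EVENT FREED: for every wall-monotone event `E` of the wider slab and every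
interior configuration `y`, the normalised weighted number of completions of `E` through an isotropic last face
column is at least the one through a honeycomb last face column.

* Constant last interior column: by `LinkConstGen` black connectivity between embedded old cells — in particular
  the wall profile — does not depend on the new column, and neither does the wall colouring
  (`LinkArcsIffStub.ext_fst_castSucc`); so membership in `E` does not depend on the new column (`WallMonotone`) and
  both normalised sums are `0` or `1` (`CylBunchStub.colSum_eq_colConst`).
* Non-constant: present the column by a necklace `N` (`stub_necklaceConst.1`).  By `H1Gen` and `WallMonotone`,
  membership of the gluing of `(y, (c, f))` in `E` is the value at the crossing vector `N.crossVec c f` of the UPWARD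
  CLOSURE `Φ` of the set of crossing vectors realised inside `E` — an increasing function (`PhiUV_mono`).  The sums
  are then regrouped by the crossing vector (`sum_fiber_crossVec`) and evaluated by `stub_linkHonCount`,
  `stub_linkIsoTraceNorm`, and compared by `stub_linkTelescope stub_linkTraceIneq`, verbatim as in the landed proof.
-/

noncomputable section

namespace Summit.CriticalPhenomena.CardyFormulaZ2.Theorems.IKLinearTransport.PinnedDiagramExchange.WallDomination

open scoped BigOperators Classical
open Finset
open Summit.CriticalPhenomena.CardyFormulaZ2.Cruxes.IKMixedBoxCrossing.DefectClosureExploration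
open CylBunchStub (resLE resLast splitEquiv colConst)

namespace LastColMonoGenStub

variable {w L : ℕ}

/-- The wall colouring of the gluing of `(y, p)` does not depend on the new column `p` (the wall cell of row `r`
of the wider slab is the `castSucc`-embedded old cell `(0, r)`). -/
theorem wallCol_ext (y : CylCfg w L) (p q : (ZMod L → Bool) × (ZMod L → Bool)) :
    wallCol ((splitEquiv w L).symm (y, p)) = wallCol ((splitEquiv w L).symm (y, q)) := by
  obtain ⟨c, f⟩ := p
  obtain ⟨c', f'⟩ := q
  funext r
  show ((splitEquiv w L).symm (y, (c, f))).1 ((0 : Fin (w + 1)).castSucc, r) =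
    ((splitEquiv w L).symm (y, (c', f'))).1 ((0 : Fin (w + 1)).castSucc, r)
  rw [LinkArcsIffStub.ext_fst_castSucc, LinkArcsIffStub.ext_fst_castSucc]

/-- If black connectivity between `castSucc`-embedded old cells transfers from the gluing of `(y, p)` to the
gluing of `(y, q)`, then so does the wall profile. -/
theorem wallRel_mono (y : CylCfg w L) (p q : (ZMod L → Bool) × (ZMod L → Bool))
    (h : ∀ u v : Fin (w + 1) × ZMod L,
      BlackConn ((splitEquiv w L).symm (y, p)) (u.1.castSucc, u.2) (v.1.castSucc, v.2) →
        BlackConn ((splitEquiv w L).symm (y, q)) (u.1.castSucc, u.2) (v.1.castSucc, v.2)) :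
    wallRel ((splitEquiv w L).symm (y, p)) ⊆ wallRel ((splitEquiv w L).symm (y, q)) :=
  fun rs hrs => h ((0 : Fin (w + 1)), rs.1) ((0 : Fin (w + 1)), rs.2) hrs

/-- Membership in a wall-monotone event transfers along "same interior, black connectivity between embedded old
cells transfers". -/
theorem mem_transfer {E : Set (CylCfg (w + 1) L)} (hE : WallMonotone E) (y : CylCfg w L)
    (p q : (ZMod L → Bool) × (ZMod L → Bool))
    (h : ∀ u v : Fin (w + 1) × ZMod L,
      BlackConn ((splitEquiv w L).symm (y, p)) (u.1.castSucc, u.2) (v.1.castSucc, v.2) →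
        BlackConn ((splitEquiv w L).symm (y, q)) (u.1.castSucc, u.2) (v.1.castSucc, v.2))
    (hp : (splitEquiv w L).symm (y, p) ∈ E) : (splitEquiv w L).symm (y, q) ∈ E :=
  hE _ _ (wallCol_ext y p q) (wallRel_mono y p q h) hp

end LastColMonoGenStub

open LastColMonoGenStub in
/-- **`stub_lastColMonoGen`** (registered sub-goal of line `pinned-diagram-exchange`): POINTWISE LAST-COLUMN
MONOTONICITY FOR WALL-MONOTONE EVENTS from `H1Gen` and `LinkConstGen` (and the landed link decomposition
`stub_necklaceConst`, `stub_linkHonCount`, `stub_linkIsoTraceNorm`, `stub_linkTelescope`, `stub_linkTraceIneq`). -/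
theorem stub_lastColMonoGen : H1Gen → LinkConstGen → LastColMonoGen := by
  intro h1 hC w L _ hL E hE y
  set ξ : ZMod L → Bool := fun r => y.1 (Fin.last w, r) with hξ
  have hcF : 0 < colConst false L := CylBunchStub.colConst_pos false L
  have hcT : 0 < colConst true L := CylBunchStub.colConst_pos true L
  by_cases hconst : ∃ b : Bool, ∀ r, ξ r = b
  · -- constant last interior column: the event does not depend on the new column
    obtain ⟨b, hb⟩ := hconst
    have key0 : ∀ p q : (ZMod L → Bool) × (ZMod L → Bool),
        (splitEquiv w L).symm (y, p) ∈ E → (splitEquiv w L).symm (y, q) ∈ E :=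
      fun p q => mem_transfer hE y p q fun u v => (hC w L y b hb p q u v).1
    have key : ∀ b' : Bool, lastColSum b' L E y =
        (if (splitEquiv w L).symm (y, (fun _ => false, fun _ => true)) ∈ E then 1 else 0) * colConst b' L := by
      intro b'
      unfold lastColSum
      by_cases hmem : (splitEquiv w L).symm (y, (fun _ => false, fun _ => true)) ∈ E
      · rw [if_pos hmem, one_mul]
        rw [show colConst b' L = ∑ p : (ZMod L → Bool) × (ZMod L → Bool),
            lastColWeight b' L (fun r => y.1 (Fin.last w, r)) p.1 p.2 from ?_]
        · exact Finset.sum_congr rfl fun p _ => by rw [if_pos (key0 _ p hmem)]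
        · rw [← CylBunchStub.colSum_eq_colConst b' L (fun r => y.1 (Fin.last w, r)), Fintype.sum_prod_type]
          rfl
      · rw [if_neg hmem, zero_mul]
        exact Finset.sum_eq_zero fun p _ => by rw [if_neg (fun h => hmem (key0 p _ h))]
    rw [key false, key true, mul_div_assoc, mul_div_assoc, div_self hcF.ne', div_self hcT.ne']
  · -- non-constant: necklace presentation and the upward closure of the realised crossing vectors
    push Not at hconst
    have htrue : ∃ r, ξ r = true := by
      by_contra h
      push Not at h
      obtain ⟨r, hr⟩ := hconst false
      exact hr (by simpa using h r)
    have hfalse : ∃ r, ξ r = false := by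
      by_contra h
      push Not at h
      obtain ⟨r, hr⟩ := hconst true
      exact hr (by simpa using h r)
    obtain ⟨N, hNcol⟩ := stub_necklaceConst.1 L ξ htrue hfalse
    obtain ⟨hnF, hnT, hWpos⟩ := stub_linkIsoTraceNorm.2 L N
    -- the upward closure of the set of crossing vectors realised inside `E`
    obtain ⟨Φ, hΦdef⟩ : ∃ Φ : (Fin N.k → Bool) → Prop, ∀ x, Φ x ↔
        ∃ c f : ZMod L → Bool, N.crossVec c f ≤ x ∧ (splitEquiv w L).symm (y, (c, f)) ∈ E :=
      ⟨_, fun _ => Iff.rfl⟩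
    have hΦ : ∀ x x', x ≤ x' → Φ x → Φ x' := fun x x' hle hx => by
      obtain ⟨c, f, hcf, hm⟩ := (hΦdef x).1 hx
      exact (hΦdef x').2 ⟨c, f, hcf.trans hle, hm⟩
    have memE : ∀ c f : ZMod L → Bool, (splitEquiv w L).symm (y, (c, f)) ∈ E ↔ Φ (N.crossVec c f) := by
      intro c f
      refine ⟨fun h => (hΦdef _).2 ⟨c, f, le_rfl, h⟩, fun h => ?_⟩
      obtain ⟨c₀, f₀, hle, h₀⟩ := (hΦdef _).1 h
      exact mem_transfer hE y (c₀, f₀) (c, f) (fun u v huv => (h1 w L y N hNcol c f u v).2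
        (PhiUV_mono N y u v hle ((h1 w L y N hNcol c₀ f₀ u v).1 huv))) h₀
    have hsum : ∀ b' : Bool, lastColSum b' L E y = ∑ x : Fin N.k → Bool, if Φ x then
        (∑ p : (ZMod L → Bool) × (ZMod L → Bool),
          if N.crossVec p.1 p.2 = x then lastColWeight b' L N.col p.1 p.2 else 0) else 0 := by
      intro b'
      unfold lastColSum
      rw [← sum_fiber_crossVec N (fun p => lastColWeight b' L N.col p.1 p.2) Φ]
      refine Finset.sum_congr rfl fun p _ => ?_
      rw [hNcol]
      obtain ⟨c, f⟩ := p
      by_cases hm : (splitEquiv w L).symm (y, (c, f)) ∈ E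
      · rw [if_pos hm, if_pos ((memE c f).1 hm)]
      · rw [if_neg hm, if_neg (fun h => hm ((memE c f).2 h))]
    have hF : lastColSum false L E y = (2 : ℝ) ^ L * ∑ x : Fin N.k → Bool, if Φ x then N.honW x else 0 := by
      rw [hsum false, Finset.mul_sum]
      refine Finset.sum_congr rfl fun x _ => ?_
      split_ifs
      · exact stub_linkHonCount L N x
      · rw [mul_zero]
    have hT : lastColSum true L E y = ∑ x : Fin N.k → Bool, if Φ x then N.W ∅ x else 0 := by
      rw [hsum true]
      refine Finset.sum_congr rfl fun x _ => ?_
      split_ifs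
      · exact stub_linkIsoTraceNorm.1 L N x
      · rfl
    have htel := stub_linkTelescope stub_linkTraceIneq L N hL Φ hΦ
    rw [hF, hT, hnF, hnT, mul_div_cancel_left₀ _ (by positivity), le_div_iff₀ hWpos]
    linarith [mul_comm (N.W Finset.univ (fun _ => true)) (∑ x : Fin N.k → Bool, if Φ x then N.honW x else 0)]

end Summit.CriticalPhenomena.CardyFormulaZ2.Theorems.IKLinearTransport.PinnedDiagramExchange.WallDomination

end
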